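import Mathlib
import HarnessLib
import Summits.Ventures.LatticeQCDFlow.Scoring.U1TorusCharacterFormula
import Summits.Ventures.LatticeQCDFlow.Scaling.AcceptanceVolumeDecayPi
import Summits.Ventures.LatticeQCDFlow.Scaling.AcceptanceEssEightNinthsDensities

/-!
# LatticeQCDFlow / Scaling — the UNTRAINED (identity-flow) baseline of the U(1) Wilson sampler on
# ANY finite complex and on the periodic `L₁ × L₂` TORUS, in closed form:
# `ESS = Z(β)²/((2π)^{#links} Z(2β))`, `(8/9)·ESS ≤ acc ≤ Z(β/2)²/((2π)^{#links} Z(β))`;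
# on the torus `ESS = (Σₖ I_{|k|}(β)^V)²/Σₖ I_{|k|}(2β)^V`, `acc ≤ (Σₖ I_{|k|}(β/2)^V)²/Σₖ I_{|k|}(β)^V`

HONEST FRAMING: exact (Metropolis-corrected) sampling algorithms for lattice gauge theory;
figures of merit are autocorrelation/cost numbers at stated couplings and volumes; no
continuum-physics claim.

Venture `LatticeQCDFlow` (cell pub-lqcd), topic `Scaling`; FANOUT row 3 (`s0-u1-a`, S0-B
implementation A: the 2-d U(1) flow sampler, GEN-13).  NEW WORK of the cell (closed forms, no
numerics), the PERIODIC-TORUS version of row 3's `Scaling/U1IdentityFlowVolumeLaw` (GEN-12: `V`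
independent plaquettes = open b.c. in axial gauge; the torus was listed there as NOT CLAIMED).  Setting
= row 5's `Scoring/SchwingerDysonLattice` / `Scoring/U1CharacterExpansion` / `Scoring/U1TorusCharacterFormula`
(imported): `n + 1` link angles on the torus box `(0, 2π]^{n+1}` with Lebesgue measure, a finite family
of plaquettes `p ∈ Ps` with integer incidences `inc p l` and couplings `β_p`, Wilson weight
`W_β(θ) = exp(Σ_p β_p cos θ_p)`, partition function `Z(β) = u1WilsonZ = ∫ W_β`.  The IDENTITY FLOW
proposes links from the product Haar prior (density `q = (2π)^{−(n+1)}`) and Metropolis-corrects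
against the Wilson law (density `p = W_β/Z(β)`); since `W_β² = W_{2β}` and `√W_β = W_{β/2}`
pointwise, every figure of merit of this exact sampler is a ratio of partition functions:

* §1 `u1WilsonWeight_sq` / `sqrt_u1WilsonWeight` (`W_β² = W_{2β}`, `√W_β = W_{β/2}`),
  `volume_real_u1TorusBox` (`|(0,2π]^m| = (2π)^m`), normalisations `integral_u1WilsonD`,
  `integral_u1HaarD`;
* §2 **`integral_u1WilsonD_sq_div`** `∫ p²/q = (2π)^{n+1} Z(2β)/Z(β)²`,
  **`u1WilsonIdentityFlow_essFrac`** `ESS = (∫p)²/∫p²/q = Z(β)²/((2π)^{n+1} Z(2β))` EXACTLY,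
  **`integral_sqrt_u1WilsonD_mul`** `BC = ∫√(pq) = Z(β/2)/√((2π)^{n+1} Z(β))`, and
  **`u1WilsonIdentityFlow_meanAccept_mem_Icc`**
  `(8/9)·Z(β)²/((2π)^{n+1}Z(2β)) ≤ acc ≤ Z(β/2)²/((2π)^{n+1}Z(β))` (floor: row 3's general-space 8/9
  law `Scaling/AcceptanceEssEightNinthsDensities`; ceiling: the Bhattacharyya law of
  `Scaling/AcceptanceVolumeDecayPi`) — on ANY finite complex (any dimension, boundary condition,
  defect couplings);
* §3 the `L₁ × L₂` periodic torus at uniform coupling (`V = L₁L₂` plaquettes, `2V` links, row 5's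
  `torus_u1WilsonZ_uniform` `Z = (2π)^{n+1} Σₖ I_{|k|}(β)^V`): **`u1TorusIdentityFlow_essFrac`**
  `ESS = (Σₖ I_{|k|}(β)^V)² / Σₖ I_{|k|}(2β)^V` and **`u1TorusIdentityFlow_meanAccept_mem_Icc`**
  `(8/9)·(Σₖ I_{|k|}(β)^V)²/Σₖ I_{|k|}(2β)^V ≤ acc ≤ (Σₖ I_{|k|}(β/2)^V)²/Σₖ I_{|k|}(β)^V`.

Reading (value-free; no number of ours is computed or implied): the zero-training row of the S0-B board
on the periodic torus differs from the factorised (open-b.c.) row of GEN-12 exactly by replacing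
`I₀(γ)^V` with the sector sum `Σₖ I_{|k|}(γ)^V` at `γ = β, 2β, β/2`.  NOT CLAIMED: any value at the
cell's `(β, L)`; the large-`V` asymptotics of the sector sums; holding time and KL (companion file);
nothing re-scored, SEALED.md untouched.
-/

noncomputable section

namespace Summit.Ventures.LatticeQCDFlow.Theory2

open MeasureTheory Real Set Finset
open Literature.Analysis.FunctionSpaces (besselI)
open Summit.Ventures.LatticeQCDFlow.Scoring

/-! ## §1 The Wilson weight under doubling / halving the couplings; normalisations -/

section General

variable {n : ℕ} {ι : Type*} (Ps : Finset ι) (inc : ι → Fin (n + 1) → ℤ) (βp : ι → ℝ)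

/-- `W_β(θ)² = W_{2β}(θ)`. [folklore] -/
theorem u1WilsonWeight_sq (θ : Fin (n + 1) → ℝ) :
    u1WilsonWeight Ps inc βp θ ^ 2 = u1WilsonWeight Ps inc (fun p => 2 * βp p) θ := by
  unfold u1WilsonWeight
  rw [sq, ← Real.exp_add, ← two_mul, mul_sum]
  congr 1
  exact sum_congr rfl fun p _ => by ring

/-- `√(W_β(θ)) = W_{β/2}(θ)`. [folklore] -/
theorem sqrt_u1WilsonWeight (θ : Fin (n + 1) → ℝ) :
    Real.sqrt (u1WilsonWeight Ps inc βp θ) = u1WilsonWeight Ps inc (fun p => βp p / 2) θ := by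
  unfold u1WilsonWeight
  rw [← Real.exp_half, sum_div]
  congr 1
  exact sum_congr rfl fun p _ => by ring

/-- The Wilson weight is positive. [folklore] -/
theorem u1WilsonWeight_pos (θ : Fin (n + 1) → ℝ) : 0 < u1WilsonWeight Ps inc βp θ := Real.exp_pos _

/-- `|(0, 2π]^m| = (2π)^m`. [folklore] -/
theorem volume_real_u1TorusBox (m : ℕ) : volume.real (u1TorusBox m) = (2 * π) ^ m := by
  rw [measureReal_def, u1TorusBox, volume_pi_pi]
  simp only [Real.volume_Ioc, sub_zero, prod_const, card_univ, Fintype.card_fin]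
  rw [ENNReal.toReal_pow, ENNReal.toReal_ofReal (by positivity)]

/-- The restricted Lebesgue measure on the torus box is finite. [folklore] -/
theorem isFiniteMeasure_volume_restrict_u1TorusBox (m : ℕ) :
    IsFiniteMeasure ((volume : Measure (Fin m → ℝ)).restrict (u1TorusBox m)) :=
  isFiniteMeasure_restrict.2 (volume_u1TorusBox_ne_top m)

/-- `∫_{(0,2π]^m} c dθ = (2π)^m · c`. [folklore] -/
theorem setIntegral_u1TorusBox_const (m : ℕ) (c : ℝ) :
    ∫ _θ in u1TorusBox m, c = (2 * π) ^ m * c := by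
  rw [setIntegral_const, volume_real_u1TorusBox, smul_eq_mul]

/-- The Haar model density integrates to one: `∫ (2π)^{−(n+1)} = 1`. [folklore] -/
theorem integral_u1HaarD :
    ∫ _θ in u1TorusBox (n + 1), (1 / (2 * π) ^ (n + 1) : ℝ) = 1 := by
  rw [setIntegral_u1TorusBox_const]
  field_simp

/-- The Wilson density integrates to one: `∫ W/Z = 1`. [folklore] -/
theorem integral_u1WilsonD :
    ∫ θ in u1TorusBox (n + 1), u1WilsonWeight Ps inc βp θ / u1WilsonZ Ps inc βp = 1 := by
  rw [integral_div, ← u1WilsonZ, div_self (u1WilsonZ_pos Ps inc βp).ne']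

/-- The Wilson weight is integrable on the torus box. [folklore] -/
theorem integrable_u1WilsonWeight :
    Integrable (u1WilsonWeight Ps inc βp) (volume.restrict (u1TorusBox (n + 1))) :=
  integrableOn_u1TorusBox (continuous_u1WilsonWeight Ps inc βp)

/-- The Wilson density is integrable on the torus box. [folklore] -/
theorem integrable_u1WilsonD :
    Integrable (fun θ => u1WilsonWeight Ps inc βp θ / u1WilsonZ Ps inc βp)
      (volume.restrict (u1TorusBox (n + 1))) :=
  (integrable_u1WilsonWeight Ps inc βp).div_const _

/-- The Wilson density is measurable. [folklore] -/
theorem measurable_u1WilsonD :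
    Measurable fun θ => u1WilsonWeight Ps inc βp θ / u1WilsonZ Ps inc βp :=
  (continuous_u1WilsonWeight Ps inc βp).measurable.div_const _

/-! ## §2 ESS, Bhattacharyya affinity and the acceptance sandwich on any finite complex -/

/-- **The second weight moment**: `∫ p²/q = (2π)^{n+1} Z(2β)/Z(β)²` for the Wilson density
`p = W_β/Z(β)` against the Haar density `q = (2π)^{−(n+1)}`. [ours] -/
theorem integral_u1WilsonD_sq_div :
    ∫ θ in u1TorusBox (n + 1),
        (u1WilsonWeight Ps inc βp θ / u1WilsonZ Ps inc βp) ^ 2 / (1 / (2 * π) ^ (n + 1))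
      = (2 * π) ^ (n + 1) * u1WilsonZ Ps inc (fun p => 2 * βp p) / u1WilsonZ Ps inc βp ^ 2 := by
  have e : ∀ θ, (u1WilsonWeight Ps inc βp θ / u1WilsonZ Ps inc βp) ^ 2 / (1 / (2 * π) ^ (n + 1))
      = (2 * π) ^ (n + 1) / u1WilsonZ Ps inc βp ^ 2 * u1WilsonWeight Ps inc (fun p => 2 * βp p) θ := by
    intro θ
    rw [div_pow, u1WilsonWeight_sq]
    field_simp
  simp_rw [e]
  rw [integral_const_mul, ← u1WilsonZ]
  field_simp

/-- **`ESS = Z(β)²/((2π)^{n+1} Z(2β))` EXACTLY** — the effective-sample-size fraction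
`(∫p)²/∫(p²/q)` of the identity flow (Haar proposals, Wilson target) on any finite complex. [ours] -/
theorem u1WilsonIdentityFlow_essFrac :
    (∫ θ in u1TorusBox (n + 1), u1WilsonWeight Ps inc βp θ / u1WilsonZ Ps inc βp) ^ 2
        / ∫ θ in u1TorusBox (n + 1),
          (u1WilsonWeight Ps inc βp θ / u1WilsonZ Ps inc βp) ^ 2 / (1 / (2 * π) ^ (n + 1))
      = u1WilsonZ Ps inc βp ^ 2 / ((2 * π) ^ (n + 1) * u1WilsonZ Ps inc (fun p => 2 * βp p)) := by
  rw [integral_u1WilsonD, integral_u1WilsonD_sq_div, one_pow, one_div, inv_div]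

/-- **The Bhattacharyya affinity**: `∫ √(p q) = Z(β/2)/√((2π)^{n+1} Z(β))`. [ours] -/
theorem integral_sqrt_u1WilsonD_mul :
    ∫ θ in u1TorusBox (n + 1),
        Real.sqrt (u1WilsonWeight Ps inc βp θ / u1WilsonZ Ps inc βp * (1 / (2 * π) ^ (n + 1)))
      = u1WilsonZ Ps inc (fun p => βp p / 2)
          / Real.sqrt ((2 * π) ^ (n + 1) * u1WilsonZ Ps inc βp) := by
  have hZ := u1WilsonZ_pos Ps inc βp
  have hc : (0 : ℝ) < (2 * π) ^ (n + 1) := by positivity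
  have e : ∀ θ, Real.sqrt (u1WilsonWeight Ps inc βp θ / u1WilsonZ Ps inc βp * (1 / (2 * π) ^ (n + 1)))
      = u1WilsonWeight Ps inc (fun p => βp p / 2) θ
          / Real.sqrt ((2 * π) ^ (n + 1) * u1WilsonZ Ps inc βp) := by
    intro θ
    rw [show u1WilsonWeight Ps inc βp θ / u1WilsonZ Ps inc βp * (1 / (2 * π) ^ (n + 1))
        = u1WilsonWeight Ps inc βp θ / ((2 * π) ^ (n + 1) * u1WilsonZ Ps inc βp) by field_simp,
      Real.sqrt_div' _ (mul_pos hc hZ).le, sqrt_u1WilsonWeight]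
  simp_rw [e]
  rw [integral_div, ← u1WilsonZ]

/-- **THE IDENTITY-FLOW ACCEPTANCE SANDWICH on any finite complex**:
`(8/9)·Z(β)²/((2π)^{n+1} Z(2β)) ≤ acc ≤ Z(β/2)²/((2π)^{n+1} Z(β))`, where
`acc = ∫∫ min(p(θ)q(θ′), p(θ′)q(θ))` is the equilibrium acceptance of the exact sampler proposing links
from the product Haar prior (floor: the general-space `acc ≥ (8/9)·ESS` law; ceiling: `acc ≤ BC²`).
[ours] -/
theorem u1WilsonIdentityFlow_meanAccept_mem_Icc :
    ∫ θ in u1TorusBox (n + 1), ∫ θ' in u1TorusBox (n + 1),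
        min (u1WilsonWeight Ps inc βp θ / u1WilsonZ Ps inc βp * (1 / (2 * π) ^ (n + 1)))
          (u1WilsonWeight Ps inc βp θ' / u1WilsonZ Ps inc βp * (1 / (2 * π) ^ (n + 1)))
      ∈ Set.Icc (8 / 9 * (u1WilsonZ Ps inc βp ^ 2 / ((2 * π) ^ (n + 1) * u1WilsonZ Ps inc (fun p => 2 * βp p))))
          (u1WilsonZ Ps inc (fun p => βp p / 2) ^ 2 / ((2 * π) ^ (n + 1) * u1WilsonZ Ps inc βp)) := by
  set μ : Measure (Fin (n + 1) → ℝ) := volume.restrict (u1TorusBox (n + 1)) with hμ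
  have hZ := u1WilsonZ_pos Ps inc βp
  have hc : (0 : ℝ) < (2 * π) ^ (n + 1) := by positivity
  have hw0 := u1WilsonWeight_pos Ps inc βp
  have hwm : Measurable (u1WilsonWeight Ps inc βp) := (continuous_u1WilsonWeight Ps inc βp).measurable
  have hwi : Integrable (u1WilsonWeight Ps inc βp) μ := integrable_u1WilsonWeight Ps inc βp
  have hq0 : ∀ _θ : Fin (n + 1) → ℝ, (0 : ℝ) < 1 / (2 * π) ^ (n + 1) := fun _ => by positivity
  have hqm : Measurable fun _ : Fin (n + 1) → ℝ => (1 / (2 * π) ^ (n + 1) : ℝ) := measurable_const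
  have hqi : Integrable (fun _ : Fin (n + 1) → ℝ => (1 / (2 * π) ^ (n + 1) : ℝ)) μ := by
    haveI := isFiniteMeasure_volume_restrict_u1TorusBox (n + 1)
    exact integrable_const _
  have hq1 : ∫ _θ, (1 / (2 * π) ^ (n + 1) : ℝ) ∂μ = 1 := integral_u1HaarD
  constructor
  · -- floor: the general-space 8/9 law with the unnormalised weight `W_β`
    have hW₂c : Continuous fun θ => u1WilsonWeight Ps inc βp θ / (1 / (2 * π) ^ (n + 1))
        * u1WilsonWeight Ps inc βp θ :=
      ((continuous_u1WilsonWeight Ps inc βp).div_const _).mul (continuous_u1WilsonWeight Ps inc βp)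
    have hW₂ : Integrable (fun θ => u1WilsonWeight Ps inc βp θ / (1 / (2 * π) ^ (n + 1))
        * u1WilsonWeight Ps inc βp θ) μ := integrableOn_u1TorusBox hW₂c
    have hW₂val : ∫ θ, u1WilsonWeight Ps inc βp θ / (1 / (2 * π) ^ (n + 1))
        * u1WilsonWeight Ps inc βp θ ∂μ = (2 * π) ^ (n + 1) * u1WilsonZ Ps inc (fun p => 2 * βp p) := by
      have e : ∀ θ, u1WilsonWeight Ps inc βp θ / (1 / (2 * π) ^ (n + 1)) * u1WilsonWeight Ps inc βp θ
          = (2 * π) ^ (n + 1) * u1WilsonWeight Ps inc (fun p => 2 * βp p) θ := by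
        intro θ
        rw [← u1WilsonWeight_sq]
        field_simp
      simp_rw [e]
      rw [integral_const_mul, hμ, ← u1WilsonZ]
    have h := meanAccept_overlapForm_ge_eight_ninths_ESS (μ := μ) hw0 hwm hwi hq0 hqm hqi hq1 hW₂
    have hZdef : ∫ z, u1WilsonWeight Ps inc βp z ∂μ = u1WilsonZ Ps inc βp := by rw [hμ, ← u1WilsonZ]
    rw [hZdef, hW₂val] at h
    calc 8 / 9 * (u1WilsonZ Ps inc βp ^ 2 / ((2 * π) ^ (n + 1) * u1WilsonZ Ps inc (fun p => 2 * βp p)))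
        = 8 * u1WilsonZ Ps inc βp ^ 2 / (9 * ((2 * π) ^ (n + 1) * u1WilsonZ Ps inc (fun p => 2 * βp p))) := by
          ring
      _ ≤ _ := h
  · -- ceiling: the Bhattacharyya law
    have h := meanAccept_le_sq_integral_sqrt (μ := μ) (fun θ => (div_pos (hw0 θ) hZ).le)
      (measurable_u1WilsonD Ps inc βp) (integrable_u1WilsonD Ps inc βp) (fun θ => (hq0 θ).le) hqm hqi
    rw [hμ, integral_sqrt_u1WilsonD_mul, div_pow,
      Real.sq_sqrt (mul_pos hc hZ).le] at h
    exact h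

end General

/-! ## §3 The periodic `L₁ × L₂` torus at uniform coupling -/

section Torus

variable {L₁ L₂ : ℕ} [NeZero L₁] [NeZero L₂] {n : ℕ}
  (e : Fin 2 × (Fin L₁ × Fin L₂) ≃ Fin (n + 1)) (β : ℝ)

/-- **`ESS_torus = (Σₖ I_{|k|}(β)^V)² / Σₖ I_{|k|}(2β)^V`** (`V = L₁L₂`) for the identity flow of the
2-d U(1) Wilson sampler on the periodic torus. [ours] -/
theorem u1TorusIdentityFlow_essFrac :
    (∫ θ in u1TorusBox (n + 1),
        u1WilsonWeight univ (torusInc e) (fun _ => β) θ / u1WilsonZ univ (torusInc e) (fun _ => β)) ^ 2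
        / ∫ θ in u1TorusBox (n + 1),
          (u1WilsonWeight univ (torusInc e) (fun _ => β) θ
              / u1WilsonZ univ (torusInc e) (fun _ => β)) ^ 2 / (1 / (2 * π) ^ (n + 1))
      = (∑' k : ℤ, besselI k.natAbs β ^ (L₁ * L₂)) ^ 2
          / ∑' k : ℤ, besselI k.natAbs (2 * β) ^ (L₁ * L₂) := by
  have hc : (0 : ℝ) < (2 * π) ^ (n + 1) := by positivity
  rw [u1WilsonIdentityFlow_essFrac, torus_u1WilsonZ_uniform e β, torus_u1WilsonZ_uniform e (2 * β),
    mul_pow, ← mul_assoc, ← sq, mul_div_mul_left _ _ (pow_ne_zero 2 hc.ne')]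

/-- **THE IDENTITY-FLOW ACCEPTANCE SANDWICH ON THE TORUS**:
`(8/9)·(Σₖ I_{|k|}(β)^V)²/Σₖ I_{|k|}(2β)^V ≤ acc ≤ (Σₖ I_{|k|}(β/2)^V)²/Σₖ I_{|k|}(β)^V`. [ours] -/
theorem u1TorusIdentityFlow_meanAccept_mem_Icc :
    ∫ θ in u1TorusBox (n + 1), ∫ θ' in u1TorusBox (n + 1),
        min (u1WilsonWeight univ (torusInc e) (fun _ => β) θ
              / u1WilsonZ univ (torusInc e) (fun _ => β) * (1 / (2 * π) ^ (n + 1)))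
          (u1WilsonWeight univ (torusInc e) (fun _ => β) θ'
              / u1WilsonZ univ (torusInc e) (fun _ => β) * (1 / (2 * π) ^ (n + 1)))
      ∈ Set.Icc (8 / 9 * ((∑' k : ℤ, besselI k.natAbs β ^ (L₁ * L₂)) ^ 2
            / ∑' k : ℤ, besselI k.natAbs (2 * β) ^ (L₁ * L₂)))
          ((∑' k : ℤ, besselI k.natAbs (β / 2) ^ (L₁ * L₂)) ^ 2
            / ∑' k : ℤ, besselI k.natAbs β ^ (L₁ * L₂)) := by
  have h := u1WilsonIdentityFlow_meanAccept_mem_Icc univ (torusInc e) (fun _ => β)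
  have hc : (0 : ℝ) < (2 * π) ^ (n + 1) := by positivity
  -- `((2π)^{n+1} A)² / ((2π)^{n+1}·(2π)^{n+1} B) = A²/B`
  have hS : ∀ A B : ℝ, ((2 * π) ^ (n + 1) * A) ^ 2 / ((2 * π) ^ (n + 1) * ((2 * π) ^ (n + 1) * B))
      = A ^ 2 / B := fun A B => by
    rw [mul_pow, ← mul_assoc, ← sq, mul_div_mul_left _ _ (pow_ne_zero 2 hc.ne')]
  obtain ⟨h1, h2⟩ := h
  constructor
  · calc 8 / 9 * ((∑' k : ℤ, besselI k.natAbs β ^ (L₁ * L₂)) ^ 2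
          / ∑' k : ℤ, besselI k.natAbs (2 * β) ^ (L₁ * L₂))
        = 8 / 9 * (u1WilsonZ univ (torusInc e) (fun _ => β) ^ 2
            / ((2 * π) ^ (n + 1) * u1WilsonZ univ (torusInc e) (fun _ => 2 * β))) := by
          rw [torus_u1WilsonZ_uniform e β, torus_u1WilsonZ_uniform e (2 * β), hS]
      _ ≤ _ := h1
  · calc _ ≤ u1WilsonZ univ (torusInc e) (fun _ => β / 2) ^ 2
            / ((2 * π) ^ (n + 1) * u1WilsonZ univ (torusInc e) (fun _ => β)) := h2
      _ = (∑' k : ℤ, besselI k.natAbs (β / 2) ^ (L₁ * L₂)) ^ 2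
            / ∑' k : ℤ, besselI k.natAbs β ^ (L₁ * L₂) := by
          rw [torus_u1WilsonZ_uniform e (β / 2), torus_u1WilsonZ_uniform e β, hS]

end Torus

end Summit.Ventures.LatticeQCDFlow.Theory2

end
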